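import Mathlib.LinearAlgebra.Span.Basic
import Mathlib.Algebra.Module.Submodule.Map
import Mathlib.Algebra.Algebra.Basic
import HarnessLib

/-!
# (Ind2) as an explicit group: the automorphisms of a vector space stabilising a lattice
# (Dupuy–Hilado, *The statement of Mochizuki's Corollary 3.12*, §4.9)

Dupuy–Hilado, arXiv:2004.13228 (pre-split text) §4.9 "`p`-adic Ind2", read on the page (render chunks 15–16):
"They act through the group `Aut_{ℚ_p}(K_{v⃗} : I_{v⃗}) = {φ ∈ Vect_{ℚ_p}(K_{v⃗}, K_{v⃗}) : φ(I_{v⃗}) ⊂ I_{v⃗}}`.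
Another way to see these are as `ℚ_p`-vector space automorphisms which arise as `ℤ_p`-lattice isomorphisms of
`I_{v̲}`. Abusively, we will let Ind2 denote the collection of automorphisms induced by these automorphisms on
`𝕃_p^{(j)}`, `𝕃_p`, and `𝕃` (which are given as products of the automorphisms on each of the summands)."
(§4 intro: the (Ind1) permutations "fix the lattice", and "the Ind2 indeterminacies also preserve this lattice".)

This file DEFINES that group in Mathlib generality — for a commutative ring `A`, an `A`-algebra `K`, a
`K`-module `W` and an `A`-submodule `Λ ⊆ W` (the lattice; `A = ℤ_p`, `K = ℚ_p`, `W = K_{v⃗}`, `Λ = I_{v⃗}`):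
`latticeAut K Λ ≤ (W ≃ₗ[K] W)`, the subgroup of `K`-linear automorphisms `φ` with `φ(Λ) = Λ` (as DH's second
sentence: lattice ISOMORPHISMS; the first sentence's "`⊂`" defines a monoid, and for automorphisms of finite
index lattices the two agree — we take the group form, which is what acts in (4.11)). PROVED: membership
criteria, `image_eq` (`φ '' Λ = Λ` — the form the cell's `IndPacketModel.smul_shell` field asks for), the
restriction `restrict φ : Λ ≃ₗ[A] Λ` ("arise as `ℤ_p`-lattice isomorphisms"), and stability under products is
left to the packet files (DH: "products of the automorphisms on each of the summands").
[cite: DupuyHilado2025, §4.9] Deliberately NOT here: Haar-measure preservation ("isometries", DH footnote: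
determinant a unit) — a statement about `ℚ_p`-spaces with a compact open lattice, for the measure files of
this directory (tree: `Literature.MeasureTheory.Group.PadicIntGLnVolume` pattern, `HaarTransport`).
-/

namespace Literature.IUT.LogVolume

open Pointwise

variable {A : Type*} [CommRing A] (K : Type*) [CommRing K]
variable {W : Type*} [AddCommGroup W] [Module K W] [Module A W]

/-- **`Aut_K(W : Λ)`** — the `K`-linear automorphisms of `W` mapping the `A`-lattice `Λ` ONTO itself
(Dupuy–Hilado §4.9: "`ℚ_p`-vector space automorphisms which arise as `ℤ_p`-lattice isomorphisms of `I_{v̲}`"),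
as a subgroup of `W ≃ₗ[K] W`. [cite: DupuyHilado2025, §4.9] -/
def latticeAut (Λ : Submodule A W) : Subgroup (W ≃ₗ[K] W) where
  carrier := {φ | ∀ x, φ x ∈ Λ ↔ x ∈ Λ}
  mul_mem' {φ ψ} hφ hψ := fun x => by
    rw [LinearEquiv.mul_apply]
    exact (hφ (ψ x)).trans (hψ x)
  one_mem' := fun _ => Iff.rfl
  inv_mem' {φ} hφ := fun x => by
    have h := hφ (φ⁻¹ x)
    rw [show φ (φ⁻¹ x) = x from LinearEquiv.apply_symm_apply φ x] at h
    exact h.symm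

variable {K}

/-- Membership: `φ ∈ Aut_K(W : Λ) ↔ ∀ x, (φ x ∈ Λ ↔ x ∈ Λ)`. [cite: DupuyHilado2025, §4.9] -/
theorem mem_latticeAut_iff {Λ : Submodule A W} (φ : W ≃ₗ[K] W) :
    φ ∈ latticeAut K Λ ↔ ∀ x, φ x ∈ Λ ↔ x ∈ Λ := Iff.rfl

/-- A sufficient (and the printed) condition: `φ(Λ) ⊆ Λ` and `φ⁻¹(Λ) ⊆ Λ`. [cite: DupuyHilado2025, §4.9] -/
theorem mem_latticeAut_of_mapsTo {Λ : Submodule A W} (φ : W ≃ₗ[K] W)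
    (h₁ : ∀ x ∈ Λ, φ x ∈ Λ) (h₂ : ∀ x ∈ Λ, φ.symm x ∈ Λ) : φ ∈ latticeAut K Λ := by
  intro x
  constructor
  · intro hx
    have := h₂ (φ x) hx
    rwa [LinearEquiv.symm_apply_apply] at this
  · exact h₁ x

/-- **`φ(Λ) = Λ`** for `φ ∈ Aut_K(W : Λ)` — "preserve this lattice" (§4 intro), the set-level form used by the
cell's packet interface (`IndPacketModel.smul_shell`). [cite: DupuyHilado2025, §4.9] -/
theorem latticeAut.image_eq {Λ : Submodule A W} {φ : W ≃ₗ[K] W} (hφ : φ ∈ latticeAut K Λ) :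
    φ '' (Λ : Set W) = Λ := by
  ext y
  constructor
  · rintro ⟨x, hx, rfl⟩
    exact (hφ x).mpr hx
  · intro hy
    refine ⟨φ.symm y, ?_, LinearEquiv.apply_symm_apply φ y⟩
    have := hφ (φ.symm y)
    rw [LinearEquiv.apply_symm_apply] at this
    exact this.mp hy

/-- The inverse of a lattice automorphism maps `Λ` onto `Λ` too. [cite: DupuyHilado2025, §4.9] -/
theorem latticeAut.symm_image_eq {Λ : Submodule A W} {φ : W ≃ₗ[K] W} (hφ : φ ∈ latticeAut K Λ) :
    φ.symm '' (Λ : Set W) = Λ :=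
  latticeAut.image_eq (φ := φ⁻¹) ((latticeAut K Λ).inv_mem hφ)

section Tower

variable [Algebra A K] [IsScalarTower A K W]

/-- **"arise as `ℤ_p`-lattice isomorphisms"**: a member of `Aut_K(W : Λ)` restricts to an `A`-linear
automorphism of `Λ` (`A → K → W` a scalar tower). [cite: DupuyHilado2025, §4.9] -/
def latticeAut.restrict {Λ : Submodule A W} {φ : W ≃ₗ[K] W} (hφ : φ ∈ latticeAut K Λ) : Λ ≃ₗ[A] Λ where
  toFun x := ⟨φ x.1, (hφ x.1).mpr x.2⟩
  invFun y := ⟨φ.symm y.1, by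
    have := hφ (φ.symm y.1)
    rw [LinearEquiv.apply_symm_apply] at this
    exact this.mp y.2⟩
  map_add' x y := by ext; simp
  map_smul' a x := by
    ext
    simp only [Submodule.coe_smul, RingHom.id_apply]
    rw [← algebraMap_smul K a (x : W), LinearEquiv.map_smul, algebraMap_smul]
  left_inv x := by ext; simp
  right_inv y := by ext; simp

/-- The restriction acts as `φ` on underlying vectors. [cite: DupuyHilado2025, §4.9] -/
@[simp] theorem latticeAut.coe_restrict_apply {Λ : Submodule A W} {φ : W ≃ₗ[K] W}
    (hφ : φ ∈ latticeAut K Λ) (x : Λ) : ((latticeAut.restrict hφ x : Λ) : W) = φ x := rfl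

end Tower

/-- Conversely an `A`-linear automorphism of `Λ` that extends to a `K`-linear automorphism `φ` of `W` puts `φ`
in `Aut_K(W : Λ)`. [cite: DupuyHilado2025, §4.9] -/
theorem mem_latticeAut_of_restricts {Λ : Submodule A W} (φ : W ≃ₗ[K] W) (g : Λ ≃ₗ[A] Λ)
    (hg : ∀ x : Λ, ((g x : Λ) : W) = φ x) : φ ∈ latticeAut K Λ := by
  refine mem_latticeAut_of_mapsTo φ (fun x hx => ?_) (fun x hx => ?_)
  · have := (g ⟨x, hx⟩).2
    rwa [hg] at this
  · have h := hg (g.symm ⟨x, hx⟩)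
    rw [LinearEquiv.apply_symm_apply] at h
    have h' : φ.symm x = ((g.symm ⟨x, hx⟩ : Λ) : W) := by
      rw [LinearEquiv.symm_apply_eq, ← h]
    rw [h']
    exact (g.symm ⟨x, hx⟩).2


/-- `Aut_K(W : Λ)` acts on `W`; every element maps `Λ` onto `Λ` (coercion form).
[cite: DupuyHilado2025, §4.9] -/
theorem latticeAut.smul_coe_eq {Λ : Submodule A W} (φ : latticeAut K Λ) :
    (φ : W ≃ₗ[K] W) '' (Λ : Set W) = Λ :=
  latticeAut.image_eq φ.2

end Literature.IUT.LogVolume
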